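import Summits.QuantumFields.BalabanUV.T4Continuum.Support.NE7LevelMassBudget
import HarnessLib

/-!
# NE7LevelMassBudgetGrowth — THE LEVEL-MASS BUDGET, GROWTH-TOLERANT: composite-lift letters with a ratio `ρ` (`ρ² < L³`) in place of `L`
# `Σ_{i≤m} (L³)⁻¹^{m−i}·‖X_i‖² ≤ (2C̄²∕(1 − ρ²∕L³))·(ρ²·‖v‖² + 2Σ_{k≤m}(ρ∕L³)^{m−k}·‖J_k‖²)` — composites may grow like `g^ℓ·L^{ℓ(d−2)}` with any `g < √L`
# (lineage `b2b-balaban-t4-ne7b-p1`, gen 162; route (H′), memo `t4/b2b-balaban-t4-ne7b-p1/g162/records/SCOPING-LEVELMASSES.md` §8–§10; sequel of ✓ `NE7LevelMassBudget`)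

Cell `pub-balaban`, rung (B)+1 sub-cell t4, lineage `b2b-balaban-t4-ne7b-p1` (row NE7b OWNER + CRUX PROVER; junction service for row NE7 on ROAD-G116 §6 (G3)), generation 162.
WHY.  ✓ `NE7LevelMassBudget.levelMassBudget` takes the composite-lift letters with the exact interpolation scaling `L^{k−i}` (`= (L^{k−i})^{(d−2)∕2}` at `d = 4`).  The numerics of memo §9∕§10
(kit j345015, j345052, j345057) show that the composites of the exact de Rham lift `r = W∘A⁻¹` are bounded TRANSVERSALLY (tent factor `→ 2.60·L^ℓ`) but the LONGITUDINAL flat factor grows slowly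
with the number of levels (`f_ℓ∕L^ℓ = 4.0, 6.4, 8.7, 10.9, …` at `L = 2`).  The geometric weights absorb any growth `g^{k−i}` with `g < √L` (root form: the budget converges iff `(gL)² < L³`):
this file is the budget with a free ratio `ρ = gL`.
WHAT ([folklore]; 0 def, 0 sorry): **`weighted_sq_sum_le_of_growth`** (`ρ ≥ 2`, `0 < w`, `wρ² < 1`): `a_i ≤ C̄(ρ^{m+1−i}A + Σ_{k∈[i,m]} ρ^{k−i}b_k)` ⇒
`Σ_{i≤m} w^{m−i}a_i² ≤ (2C̄²∕(1−wρ²))·(ρ²A² + 2Σ_{k≤m}(wρ)^{m−k}b_k²)`; **`levelMassBudget_of_growth`** (`L ≥ 2`, `2 ≤ ρ`, `ρ² < L³`, `w = L⁻³`): the `√dirSq` headline.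
HONEST FRAMING (page 1): real bookkeeping about OUR objects; nothing of Bałaban's asserted; NOT (G3), NOT (G), NOT NE7∕NE3 as spine nodes; row NE7b NOT PRINTED ∕ NOT PROVED; spine 0∕9; finite T⁴
rung (B)+1 — NOT infinite volume, NOT mass gap, NOT BetaPertH, NOT Clay.
-/

set_option autoImplicit false

open scoped BigOperators Matrix Matrix.Norms.L2Operator
open Finset

namespace Summit.QuantumFields.BalabanUV.T4Continuum.NE7LevelMassBudgetGrowth

open Literature.MathematicalPhysics.QuantumFieldTheory.Balaban1983to89
open B7Prop1Explicit
open T4AveragingDeficitWall (dirSq)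
open NE3LiftDefectCorrection (sqrt_dirSq_add_le)
open NE7LevelMassBudget (seminorm_tower_le dirSq_zero)

noncomputable section

variable {d : ℕ} {n : Type*} [Fintype n] [DecidableEq n]

/-! ## §1 The weighted square sum with a free ratio -/

omit [Fintype n] [DecidableEq n] in
/-- **THE WEIGHTED SQUARE SUM, GROWTH-TOLERANT** (`ρ ≥ 2`, `0 < w`, `w·ρ² < 1`; `A, b_k ≥ 0`): if `0 ≤ a_i ≤ C̄·(ρ^{m+1−i}·A + Σ_{k∈[i,m]} ρ^{k−i}·b_k)` for every `i ≤ m`, then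
`Σ_{i≤m} w^{m−i}·a_i² ≤ (2C̄²∕(1 − wρ²))·(ρ²·A² + 2·Σ_{k≤m} (wρ)^{m−k}·b_k²)`. [folklore] -/
theorem weighted_sq_sum_le_of_growth {w ρ : ℝ} (hw : 0 < w) (hρ : 2 ≤ ρ) (hwρ : w * ρ ^ 2 < 1) (m : ℕ) {Cb A : ℝ} (hA : 0 ≤ A)
    {a b : ℕ → ℝ} (ha0 : ∀ i ≤ m, 0 ≤ a i) (hb0 : ∀ k ≤ m, 0 ≤ b k)
    (ha : ∀ i ≤ m, a i ≤ Cb * (ρ ^ (m + 1 - i) * A + ∑ k ∈ Ico i (m + 1), ρ ^ (k - i) * b k)) :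
    ∑ i ∈ range (m + 1), w ^ (m - i) * a i ^ 2
      ≤ (2 * Cb ^ 2 / (1 - w * ρ ^ 2)) * (ρ ^ 2 * A ^ 2 + 2 * ∑ k ∈ range (m + 1), (w * ρ) ^ (m - k) * b k ^ 2) := by
  have hρ0 : 0 < ρ := by linarith
  set q : ℝ := w * ρ ^ 2 with hq
  have hq0 : 0 ≤ q := by positivity
  have hq1 : 0 < 1 - q := by linarith
  -- geometric sums in `q`
  have hgeomq : ∀ n' : ℕ, ∑ j ∈ range n', q ^ j ≤ 1 / (1 - q) := fun n' => NE3FramePotBound.geom_sum_le_inv hq0 hwρ n'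
  -- `Σ_{k∈[i,m]} ρ^{k-i} ≤ 2ρ^{m-i}`
  have hgeomρ : ∀ i ≤ m, ∑ k ∈ Ico i (m + 1), ρ ^ (k - i) ≤ 2 * ρ ^ (m - i) := by
    intro i hi
    obtain ⟨t, rfl⟩ : ∃ t, m = i + t := ⟨m - i, by omega⟩
    rw [Finset.sum_Ico_eq_sum_range, show i + t + 1 - i = t + 1 by omega, show i + t - i = t by omega,
      Finset.sum_congr rfl fun k _ => by rw [Nat.add_sub_cancel_left]]
    -- `Σ_{k≤t} ρ^k = ρ^t Σ_{k≤t} (ρ⁻¹)^{t-k} ≤ ρ^t · 1/(1-ρ⁻¹) ≤ 2ρ^t`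
    have hrefl : ∑ k ∈ range (t + 1), ρ ^ k = ρ ^ t * ∑ k ∈ range (t + 1), (ρ⁻¹) ^ k := by
      rw [Finset.mul_sum]
      have h := Finset.sum_range_reflect (fun k => ρ ^ k) (t + 1)
      rw [← h]
      refine Finset.sum_congr rfl fun k hk => ?_
      have hk' : k ≤ t := by have := Finset.mem_range.mp hk; omega
      simp only [add_tsub_cancel_right]
      rw [inv_pow, ← div_eq_mul_inv, eq_div_iff (pow_ne_zero _ hρ0.ne'), ← pow_add, Nat.sub_add_cancel hk']
    rw [hrefl, mul_comm]
    refine mul_le_mul_of_nonneg_right ?_ (pow_nonneg hρ0.le _)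
    have hg := NE3FramePotBound.geom_sum_le_inv (q := ρ⁻¹) (by positivity) (by rw [inv_lt_one₀ hρ0]; linarith) (t + 1)
    refine hg.trans ?_
    rw [div_le_iff₀ (by rw [sub_pos, inv_lt_one₀ hρ0]; linarith)]
    have : ρ⁻¹ ≤ 1 / 2 := by rw [inv_le_comm₀ hρ0 (by norm_num)]; linarith
    linarith
  -- Step 1: per-level bound
  have hsq : ∀ i ∈ range (m + 1), w ^ (m - i) * a i ^ 2
      ≤ 2 * Cb ^ 2 * A ^ 2 * (ρ ^ 2 * q ^ (m - i)) + 4 * Cb ^ 2 * ∑ k ∈ Ico i (m + 1), ((w * ρ) ^ (m - k) * q ^ (k - i)) * b k ^ 2 := by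
    intro i hi
    have him : i ≤ m := by have := Finset.mem_range.mp hi; omega
    set S : ℝ := ∑ k ∈ Ico i (m + 1), ρ ^ (k - i) * b k with hS
    have hS0 : 0 ≤ S := Finset.sum_nonneg fun k hk => mul_nonneg (pow_nonneg hρ0.le _) (hb0 k (by have := (Finset.mem_Ico.mp hk).2; omega))
    have hP0 : 0 ≤ ρ ^ (m + 1 - i) * A := mul_nonneg (pow_nonneg hρ0.le _) hA
    have h1 : a i ^ 2 ≤ 2 * Cb ^ 2 * ((ρ ^ (m + 1 - i) * A) ^ 2 + S ^ 2) := by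
      have h := ha i him
      have h0 := ha0 i him
      calc a i ^ 2 ≤ (Cb * (ρ ^ (m + 1 - i) * A + S)) ^ 2 := pow_le_pow_left₀ h0 h 2
        _ = Cb ^ 2 * (ρ ^ (m + 1 - i) * A + S) ^ 2 := by ring
        _ ≤ Cb ^ 2 * (2 * ((ρ ^ (m + 1 - i) * A) ^ 2 + S ^ 2)) :=
            mul_le_mul_of_nonneg_left (by nlinarith [sq_nonneg (ρ ^ (m + 1 - i) * A - S)]) (sq_nonneg _)
        _ = _ := by ring
    have hCS : S ^ 2 ≤ 2 * ρ ^ (m - i) * ∑ k ∈ Ico i (m + 1), ρ ^ (k - i) * b k ^ 2 := by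
      have h := Finset.sum_mul_sq_le_sq_mul_sq (Ico i (m + 1)) (fun k => Real.sqrt (ρ ^ (k - i))) (fun k => Real.sqrt (ρ ^ (k - i)) * b k)
      have e1 : ∀ k ∈ Ico i (m + 1), Real.sqrt (ρ ^ (k - i)) * (Real.sqrt (ρ ^ (k - i)) * b k) = ρ ^ (k - i) * b k := by
        intro k _; rw [← mul_assoc, Real.mul_self_sqrt (pow_nonneg hρ0.le _)]
      have e2 : ∀ k ∈ Ico i (m + 1), Real.sqrt (ρ ^ (k - i)) ^ 2 = ρ ^ (k - i) := fun k _ => Real.sq_sqrt (pow_nonneg hρ0.le _)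
      have e3 : ∀ k ∈ Ico i (m + 1), (Real.sqrt (ρ ^ (k - i)) * b k) ^ 2 = ρ ^ (k - i) * b k ^ 2 := by
        intro k _; rw [mul_pow, Real.sq_sqrt (pow_nonneg hρ0.le _)]
      rw [Finset.sum_congr rfl e1, Finset.sum_congr rfl e2, Finset.sum_congr rfl e3, ← hS] at h
      have hT0 : 0 ≤ ∑ k ∈ Ico i (m + 1), ρ ^ (k - i) * b k ^ 2 := Finset.sum_nonneg fun k _ => mul_nonneg (pow_nonneg hρ0.le _) (sq_nonneg _)
      exact h.trans (mul_le_mul_of_nonneg_right (hgeomρ i him) hT0)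
    obtain ⟨t, rfl⟩ : ∃ t, m = i + t := ⟨m - i, by omega⟩
    have et : i + t - i = t := by omega
    have hw1 : w ^ (i + t - i) * (ρ ^ (i + t + 1 - i) * A) ^ 2 = A ^ 2 * (ρ ^ 2 * q ^ (i + t - i)) := by
      rw [et, show i + t + 1 - i = t + 1 by omega, hq, mul_pow, ← pow_mul, pow_succ, mul_pow]
      ring
    have hw2 : ∀ k ∈ Ico i (i + t + 1), w ^ (i + t - i) * ρ ^ (i + t - i) * (ρ ^ (k - i) * b k ^ 2) = ((w * ρ) ^ (i + t - k) * q ^ (k - i)) * b k ^ 2 := by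
      intro k hk
      obtain ⟨hk1, hk2⟩ := Finset.mem_Ico.mp hk
      obtain ⟨s, rfl⟩ : ∃ s, k = i + s := ⟨k - i, by omega⟩
      obtain ⟨u, rfl⟩ : ∃ u, t = s + u := ⟨t - s, by omega⟩
      rw [show i + (s + u) - i = s + u by omega, show i + s - i = s by omega, show i + (s + u) - (i + s) = u by omega, hq]
      rw [mul_pow, mul_pow, pow_add, pow_add, ← pow_mul, pow_mul]
      ring
    have hW0 : 0 ≤ w ^ (i + t - i) := pow_nonneg hw.le _
    calc w ^ (i + t - i) * a i ^ 2
        ≤ w ^ (i + t - i) * (2 * Cb ^ 2 * ((ρ ^ (i + t + 1 - i) * A) ^ 2 + S ^ 2)) := mul_le_mul_of_nonneg_left h1 hW0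
      _ ≤ w ^ (i + t - i) * (2 * Cb ^ 2 * ((ρ ^ (i + t + 1 - i) * A) ^ 2 + 2 * ρ ^ (i + t - i) * ∑ k ∈ Ico i (i + t + 1), ρ ^ (k - i) * b k ^ 2)) := by
          refine mul_le_mul_of_nonneg_left (mul_le_mul_of_nonneg_left (add_le_add le_rfl hCS) (by positivity)) hW0
      _ = 2 * Cb ^ 2 * (w ^ (i + t - i) * (ρ ^ (i + t + 1 - i) * A) ^ 2)
            + 4 * Cb ^ 2 * ((w ^ (i + t - i) * ρ ^ (i + t - i)) * ∑ k ∈ Ico i (i + t + 1), ρ ^ (k - i) * b k ^ 2) := by ring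
      _ = 2 * Cb ^ 2 * A ^ 2 * (ρ ^ 2 * q ^ (i + t - i)) + 4 * Cb ^ 2 * ∑ k ∈ Ico i (i + t + 1), ((w * ρ) ^ (i + t - k) * q ^ (k - i)) * b k ^ 2 := by
          rw [hw1, Finset.mul_sum, Finset.sum_congr rfl fun k hk => by rw [hw2 k hk]]
          ring
  -- Step 2: sum over `i`
  have hT1 : ∑ i ∈ range (m + 1), 2 * Cb ^ 2 * A ^ 2 * (ρ ^ 2 * q ^ (m - i)) ≤ 2 * Cb ^ 2 * A ^ 2 * ρ ^ 2 * (1 / (1 - q)) := by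
    rw [← Finset.mul_sum, ← Finset.mul_sum]
    have hrefl : ∑ i ∈ range (m + 1), q ^ (m - i) = ∑ i ∈ range (m + 1), q ^ i := by
      have h := Finset.sum_range_reflect (fun k => q ^ k) (m + 1)
      simpa using h
    rw [hrefl, ← mul_assoc]
    exact mul_le_mul_of_nonneg_left (hgeomq (m + 1)) (by positivity)
  have hT2 : ∑ i ∈ range (m + 1), 4 * Cb ^ 2 * ∑ k ∈ Ico i (m + 1), ((w * ρ) ^ (m - k) * q ^ (k - i)) * b k ^ 2
      ≤ 4 * Cb ^ 2 * (1 / (1 - q)) * ∑ k ∈ range (m + 1), (w * ρ) ^ (m - k) * b k ^ 2 := by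
    rw [← Finset.mul_sum]
    have hex : ∑ i ∈ range (m + 1), ∑ k ∈ Ico i (m + 1), ((w * ρ) ^ (m - k) * q ^ (k - i)) * b k ^ 2
        = ∑ k ∈ range (m + 1), ∑ i ∈ range (k + 1), ((w * ρ) ^ (m - k) * q ^ (k - i)) * b k ^ 2 := by
      refine Finset.sum_comm' fun i k => ?_
      simp only [Finset.mem_range, Finset.mem_Ico]
      omega
    rw [hex]
    have hinner : ∀ k ∈ range (m + 1), ∑ i ∈ range (k + 1), ((w * ρ) ^ (m - k) * q ^ (k - i)) * b k ^ 2 ≤ (1 / (1 - q)) * ((w * ρ) ^ (m - k) * b k ^ 2) := by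
      intro k _
      have e : ∑ i ∈ range (k + 1), ((w * ρ) ^ (m - k) * q ^ (k - i)) * b k ^ 2 = ((w * ρ) ^ (m - k) * b k ^ 2) * ∑ i ∈ range (k + 1), q ^ (k - i) := by
        rw [Finset.mul_sum]; refine Finset.sum_congr rfl fun i _ => by ring
      rw [e]
      have hrefl : ∑ i ∈ range (k + 1), q ^ (k - i) = ∑ i ∈ range (k + 1), q ^ i := by
        have h := Finset.sum_range_reflect (fun j => q ^ j) (k + 1)
        simpa using h
      rw [hrefl, mul_comm (1 / (1 - q))]
      exact mul_le_mul_of_nonneg_left (hgeomq (k + 1)) (mul_nonneg (pow_nonneg (by positivity) _) (sq_nonneg _))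
    calc 4 * Cb ^ 2 * ∑ k ∈ range (m + 1), ∑ i ∈ range (k + 1), ((w * ρ) ^ (m - k) * q ^ (k - i)) * b k ^ 2
        ≤ 4 * Cb ^ 2 * ∑ k ∈ range (m + 1), (1 / (1 - q)) * ((w * ρ) ^ (m - k) * b k ^ 2) :=
          mul_le_mul_of_nonneg_left (Finset.sum_le_sum hinner) (by positivity)
      _ = _ := by rw [← Finset.mul_sum]; ring
  calc ∑ i ∈ range (m + 1), w ^ (m - i) * a i ^ 2
      ≤ ∑ i ∈ range (m + 1), (2 * Cb ^ 2 * A ^ 2 * (ρ ^ 2 * q ^ (m - i)) + 4 * Cb ^ 2 * ∑ k ∈ Ico i (m + 1), ((w * ρ) ^ (m - k) * q ^ (k - i)) * b k ^ 2) :=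
        Finset.sum_le_sum hsq
    _ ≤ 2 * Cb ^ 2 * A ^ 2 * ρ ^ 2 * (1 / (1 - q)) + 4 * Cb ^ 2 * (1 / (1 - q)) * ∑ k ∈ range (m + 1), (w * ρ) ^ (m - k) * b k ^ 2 := by
        rw [Finset.sum_add_distrib]; exact add_le_add hT1 hT2
    _ = (2 * Cb ^ 2 / (1 - w * ρ ^ 2)) * (ρ ^ 2 * A ^ 2 + 2 * ∑ k ∈ range (m + 1), (w * ρ) ^ (m - k) * b k ^ 2) := by
        rw [hq]; field_simp; ring

/-- **THE LEVEL-MASS BUDGET, GROWTH-TOLERANT** (`L ≥ 2`, ratio `ρ ≥ 2` with `ρ² < L³` — e.g. `ρ = g·L`, `g² < L`): as `levelMassBudget`, with the composite letters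
`√dirSq (R i (m+1) v) (F i) ≤ C̄·ρ^{m+1−i}·√dirSq v (F (m+1))` and `√dirSq (R i k (J k)) (F i) ≤ C̄·ρ^{k−i}·√dirSq (J k) (F k)`:
`Σ_{i≤m} (L³)⁻¹^{m−i}·dirSq (X i) (F i) ≤ (2C̄²∕(1 − ρ²∕L³))·(ρ²·dirSq v (F (m+1)) + 2·Σ_{k≤m} (ρ∕L³)^{m−k}·dirSq (J k) (F k))`. [folklore] -/
theorem levelMassBudget_of_growth {L : ℕ} (hL : 2 ≤ L) {ρ : ℝ} (hρ : 2 ≤ ρ) (hρL : ρ ^ 2 < (L : ℝ) ^ 3) (m : ℕ) (F : ℕ → Finset (Site d))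
    (r : ℕ → (Site d → Fin d → Matrix n n ℂ) →ₗ[ℝ] (Site d → Fin d → Matrix n n ℂ))
    (R : ℕ → ℕ → (Site d → Fin d → Matrix n n ℂ) →ₗ[ℝ] (Site d → Fin d → Matrix n n ℂ))
    (hRself : ∀ k, R k k = LinearMap.id) (hRleft : ∀ i k : ℕ, i < k → (r i).comp (R (i + 1) k) = R i k)
    (X J : ℕ → Site d → Fin d → Matrix n n ℂ) (v : Site d → Fin d → Matrix n n ℂ)
    (htop : X (m + 1) = v) (hX : ∀ i ≤ m, X i = r i (X (i + 1)) + J i) {Cb : ℝ}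
    (hv : ∀ i ≤ m + 1, Real.sqrt (dirSq (R i (m + 1) v) (F i)) ≤ Cb * ρ ^ (m + 1 - i) * Real.sqrt (dirSq v (F (m + 1))))
    (hJ : ∀ i k : ℕ, i ≤ k → k ≤ m → Real.sqrt (dirSq (R i k (J k)) (F i)) ≤ Cb * ρ ^ (k - i) * Real.sqrt (dirSq (J k) (F k))) :
    ∑ i ∈ range (m + 1), (((L : ℝ) ^ 3)⁻¹) ^ (m - i) * dirSq (X i) (F i)
      ≤ (2 * Cb ^ 2 / (1 - ((L : ℝ) ^ 3)⁻¹ * ρ ^ 2))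
          * (ρ ^ 2 * dirSq v (F (m + 1)) + 2 * ∑ k ∈ range (m + 1), ((((L : ℝ) ^ 3)⁻¹) * ρ) ^ (m - k) * dirSq (J k) (F k)) := by
  have hL' : (2 : ℝ) ≤ L := by exact_mod_cast hL
  have hL3 : (0 : ℝ) < (L : ℝ) ^ 3 := by positivity
  have hw : (0 : ℝ) < ((L : ℝ) ^ 3)⁻¹ := by positivity
  have hwρ : ((L : ℝ) ^ 3)⁻¹ * ρ ^ 2 < 1 := by rw [inv_mul_lt_iff₀ hL3]; linarith
  set p : ℕ → (Site d → Fin d → Matrix n n ℂ) → ℝ := fun i Y => Real.sqrt (dirSq Y (F i)) with hp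
  have hp0 : ∀ i, p i 0 = 0 := fun i => by simp only [hp]; rw [show (0 : Site d → Fin d → Matrix n n ℂ) = fun _ _ => 0 from rfl, dirSq_zero, Real.sqrt_zero]
  have hpadd : ∀ i (a b : Site d → Fin d → Matrix n n ℂ), p i (a + b) ≤ p i a + p i b := fun i a b => sqrt_dirSq_add_le a b (F i)
  have hmain := seminorm_tower_le p hp0 hpadd r R hRself hRleft m X J v htop hX (Cb := Cb) (ρ := ρ) hv hJ
  have hdir0 : ∀ (Y : Site d → Fin d → Matrix n n ℂ) (G : Finset (Site d)), 0 ≤ dirSq Y G := by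
    intro Y G; unfold dirSq; positivity
  have hwres := weighted_sq_sum_le_of_growth hw hρ hwρ m (Real.sqrt_nonneg (dirSq v (F (m + 1)))) (a := fun i => p i (X i)) (b := fun k => p k (J k))
    (fun i _ => Real.sqrt_nonneg _) (fun k _ => Real.sqrt_nonneg _) (fun i hi => hmain i (by omega))
  simp only [hp, Real.sq_sqrt (hdir0 _ _)] at hwres
  exact hwres

end

end Summit.QuantumFields.BalabanUV.T4Continuum.NE7LevelMassBudgetGrowth
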